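import Mathlib
import HarnessLib
import Summits.Parity.Statement
import Summits.Parity.GeneralizedHardyLittlewood.Theses.SiegelSpectrumSplit
import Summits.Parity.GeneralizedHardyLittlewood.Theorems.GhostBoundaryCarvingTwoOfThreeNecessity
import Summits.Parity.GeneralizedHardyLittlewood.Theorems.ShiftedPrimeFactorNecessity
import Summits.Parity.GeneralizedHardyLittlewood.Theorems.UpperGivenBoundedSiegelGlue
import Summits.Parity.GeneralizedHardyLittlewood.Theorems.LowerGivenBoundedSiegelGlue
import Literature.NumberTheory.Sieve.PolymathBoundedGaps
import Literature.NumberTheory.Sieve.SingularSeries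

/-!
# The consecutive-prime words `DecadeStep` / `EqualGapTriple` are necessary consequences of `FixedLower`
# (helper for the record's catalogue items stmt-Parity-32327 / stmt-Parity-32337)

decomp-parity node «ConsecutivePrimeWords» (lens-3 g7, NODE HOME/STATUS.md l.409; critic CLEARED
CRITIC-LEDGER row 79 as two axis registrations; catalogued by the writer on the record route
`SiegelSpectrumSplit` rev 7 as the `[aside]` support items `DecadeStep` = stmt-Parity-32327 and
`EqualGapTriple` = stmt-Parity-32337 beneath `FixedLower` = stmt-Parity-26863, STATUS l.448; the lens's own
draft route `ConsecutivePrimeWords` was closed superseded, STATUS l.454/456).  Ported from the lens kernel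
`HOME/decomp-parity-lens-3/g7/ConsecutivePrimeWords.lean` (sha16 4ac097f5b63f2461) and its hand
`g7/hand/ConsecutivePrimeWordsNecessity.lean` onto the RECORD decls
`Theses.SiegelSpectrumSplit.DecadeStep` / `.EqualGapTriple` / `.FixedLower`:

* `frequently_forall_prime_of_weakDHL`, `isAdmissibleTuple_quadH`, `isAdmissibleTuple_sextH`,
  `frequently_quadruplet_of_fixedLower`, `frequently_sextuplet_of_fixedLower` : the dictionary engine
  (`FL ⟹ DHL[k,k]`, tree `GhostBoundaryCarving.weakDHL_of_fixedLower`, at the literals `H₄ = {0,2,6,8}`,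
  `H₆ = {0,6,12,16,18,22}` — no `def` in this Theorems file, D-0026);
* `decade_of_quadruplet`, `cpap3_of_sextuplet` : the CRT forcing lemmas (interior composites);
* `decadeStep_of_fixedLower`, `equalGapTriple_of_fixedLower`, `*_of_ghl`, `*_of_parity` : necessity, hypothesis-free;
* `fixedLower_iff : FixedLower ↔ DecadeStep ∧ EqualGapTriple ∧ (DecadeStep → EqualGapTriple → FixedLower)`
  (the node's exactness; the residual «WordLift» is spelled inline — it is ≡ `FixedLower` given the two
  words, `wordLift_iff_fixedLower`, which is why it is NOT catalogued, T21), `node_iff` (modulo the record's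
  necessity `GHL → Q`).

Helper file `--supports` the `DecadeStep` item (it closes no item: both words are open problems —
Lemke Oliver–Soundararajan's (10;1,3) word and Erdős–Turán's `d_n = d_{n+1}` i.o.).  0 sorry.
-/

open scoped BigOperators
open Finset Filter Literature.NumberTheory.Sieve

namespace Summit.Parity.GeneralizedHardyLittlewood.ConsecutivePrimeWords

open Summit.Parity.GeneralizedHardyLittlewood.Theses.SiegelSpectrumSplit (FixedLower FixedUpper
  BoundedSiegelZeroQuality UniformUpperGivenFixed UniformLowerGivenFixed DecadeStep EqualGapTriple
  upperGivenBoundedSiegelGlue_holds lowerGivenBoundedSiegelGlue_holds)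
open Summit.Parity.GeneralizedHardyLittlewood.Theses.GhostBoundaryCarving (weakDHL_of_fixedLower)

/-! ## §1 The dictionary engine: `FL ⟹ DHL[k,k] ⟹` prime constellations on `H₄`, `H₆` -/

/-- From `DHL[k,k]` on an admissible `k`-set `H`: frequently ALL of `n + h`, `h ∈ H`, are prime. -/
theorem frequently_forall_prime_of_weakDHL {k : ℕ} {H : Finset ℤ} (hH : IsAdmissibleTuple H)
    (hk : H.card = k) (h : WeakDicksonHardyLittlewood k k) :
    ∃ᶠ n : ℕ in atTop, ∀ x ∈ H, 0 < (n : ℤ) + x ∧ ((n : ℤ) + x).toNat.Prime := by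
  refine (h H hH hk).mono fun n hcard => ?_
  have hsub : H.filter (fun x ↦ 0 < (n : ℤ) + x ∧ ((n : ℤ) + x).toNat.Prime) = H :=
    Finset.eq_of_subset_of_card_le (Finset.filter_subset _ _) (by rw [hk]; exact hcard)
  intro x hx
  have hx' : x ∈ H.filter (fun x ↦ 0 < (n : ℤ) + x ∧ ((n : ℤ) + x).toNat.Prime) := by
    rw [hsub]; exact hx
  exact (Finset.mem_filter.mp hx').2

/-- `|H₄| = 4` for the prime-quadruplet pattern `H₄ = {0, 2, 6, 8}` (kept as a literal: no `def` in a
Theorems file). -/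
theorem quadH_card : ({0, 2, 6, 8} : Finset ℤ).card = 4 := by decide

/-- `|H₆| = 6` for the sextuple `H₆ = {0, 6, 12, 16, 18, 22}`. -/
theorem sextH_card : ({0, 6, 12, 16, 18, 22} : Finset ℤ).card = 6 := by decide

/-- `H₄ = {0, 2, 6, 8}` is admissible (classes mod 2: `{0}`, mod 3: `{0,2}`). -/
theorem isAdmissibleTuple_quadH : IsAdmissibleTuple ({0, 2, 6, 8} : Finset ℤ) := by
  rw [isAdmissibleTuple_iff_of_le_card, quadH_card]
  intro p hp hle
  interval_cases p <;> first | exact absurd hp (by decide) | decide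

/-- `H₆ = {0, 6, 12, 16, 18, 22}` is admissible (classes mod 2: `{0}`, mod 3: `{0,1}`, mod 5: `{0,1,2,3}`). -/
theorem isAdmissibleTuple_sextH : IsAdmissibleTuple ({0, 6, 12, 16, 18, 22} : Finset ℤ) := by
  rw [isAdmissibleTuple_iff_of_le_card, sextH_card]
  intro p hp hle
  interval_cases p <;> first | exact absurd hp (by decide) | decide

/-- `FL ⟹` frequently `n, n+2, n+6, n+8` are all prime (tree: `weakDHL_of_fixedLower` at `k = 4`). -/
theorem frequently_quadruplet_of_fixedLower (hFL : FixedLower) :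
    ∃ᶠ n : ℕ in atTop, n.Prime ∧ (n + 2).Prime ∧ (n + 6).Prime ∧ (n + 8).Prime := by
  have h := frequently_forall_prime_of_weakDHL isAdmissibleTuple_quadH quadH_card
    (weakDHL_of_fixedLower hFL 4)
  refine h.mono fun n hn => ?_
  have m0 : (0 : ℤ) ∈ ({0, 2, 6, 8} : Finset ℤ) := by simp
  have m2 : (2 : ℤ) ∈ ({0, 2, 6, 8} : Finset ℤ) := by simp
  have m6 : (6 : ℤ) ∈ ({0, 2, 6, 8} : Finset ℤ) := by simp
  have m8 : (8 : ℤ) ∈ ({0, 2, 6, 8} : Finset ℤ) := by simp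
  have e0 : ((n : ℤ) + 0).toNat = n := by omega
  have e2 : ((n : ℤ) + 2).toNat = n + 2 := by omega
  have e6 : ((n : ℤ) + 6).toNat = n + 6 := by omega
  have e8 : ((n : ℤ) + 8).toNat = n + 8 := by omega
  exact ⟨e0 ▸ (hn 0 m0).2, e2 ▸ (hn 2 m2).2, e6 ▸ (hn 6 m6).2, e8 ▸ (hn 8 m8).2⟩

/-- `FL ⟹` frequently `n, n+6, n+12, n+16, n+18, n+22` are all prime (`k = 6`). -/
theorem frequently_sextuplet_of_fixedLower (hFL : FixedLower) :
    ∃ᶠ n : ℕ in atTop, n.Prime ∧ (n + 6).Prime ∧ (n + 12).Prime ∧ (n + 16).Prime ∧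
      (n + 18).Prime ∧ (n + 22).Prime := by
  have h := frequently_forall_prime_of_weakDHL isAdmissibleTuple_sextH sextH_card
    (weakDHL_of_fixedLower hFL 6)
  refine h.mono fun n hn => ?_
  have m0 : (0 : ℤ) ∈ ({0, 6, 12, 16, 18, 22} : Finset ℤ) := by simp
  have m6 : (6 : ℤ) ∈ ({0, 6, 12, 16, 18, 22} : Finset ℤ) := by simp
  have m12 : (12 : ℤ) ∈ ({0, 6, 12, 16, 18, 22} : Finset ℤ) := by simp
  have m16 : (16 : ℤ) ∈ ({0, 6, 12, 16, 18, 22} : Finset ℤ) := by simp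
  have m18 : (18 : ℤ) ∈ ({0, 6, 12, 16, 18, 22} : Finset ℤ) := by simp
  have m22 : (22 : ℤ) ∈ ({0, 6, 12, 16, 18, 22} : Finset ℤ) := by simp
  have e0 : ((n : ℤ) + 0).toNat = n := by omega
  have e6 : ((n : ℤ) + 6).toNat = n + 6 := by omega
  have e12 : ((n : ℤ) + 12).toNat = n + 12 := by omega
  have e16 : ((n : ℤ) + 16).toNat = n + 16 := by omega
  have e18 : ((n : ℤ) + 18).toNat = n + 18 := by omega
  have e22 : ((n : ℤ) + 22).toNat = n + 22 := by omega
  exact ⟨e0 ▸ (hn 0 m0).2, e6 ▸ (hn 6 m6).2, e12 ▸ (hn 12 m12).2, e16 ▸ (hn 16 m16).2,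
    e18 ▸ (hn 18 m18).2, e22 ▸ (hn 22 m22).2⟩

/-! ## §2 The elementary forcing lemmas (CRT on the interior of the constellation) -/

/-- A prime exceeding `p > 1` is not divisible by `p`. -/
theorem not_dvd_of_prime_gt {p n : ℕ} (hp : 1 < p) (hn : p < n) (h : n.Prime) : ¬ p ∣ n :=
  fun hd => by rcases h.eq_one_or_self_of_dvd p hd with h' | h' <;> omega

/-- **Quadruplet decades**: if `n, n+2, n+6, n+8` are prime and `n ≥ 7` then `n ≡ 11 (mod 30)`; in
particular `n ≡ 1`, `n + 2 ≡ 3 (mod 10)` and no prime lies strictly between `n` and `n + 2`. -/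
theorem decade_of_quadruplet {n : ℕ} (hn : 7 ≤ n) (h0 : n.Prime) (h2 : (n + 2).Prime)
    (h6 : (n + 6).Prime) (h8 : (n + 8).Prime) :
    n % 10 = 1 ∧ (n + 2) % 10 = 3 ∧ ∀ m : ℕ, n < m → m < n + 2 → ¬ m.Prime := by
  have a2 := not_dvd_of_prime_gt (p := 2) (by norm_num) (by omega) h0
  have a5 := not_dvd_of_prime_gt (p := 5) (by norm_num) (by omega) h0
  have b5 := not_dvd_of_prime_gt (p := 5) (by norm_num) (by omega) h2
  have c5 := not_dvd_of_prime_gt (p := 5) (by norm_num) (by omega) h6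
  have d5 := not_dvd_of_prime_gt (p := 5) (by norm_num) (by omega) h8
  have r2 : n % 2 = 1 := by omega
  have r5 : n % 5 = 1 := by
    have := Nat.mod_lt n (show 0 < 5 by norm_num)
    interval_cases h : n % 5 <;> omega
  refine ⟨by omega, by omega, fun m hm1 hm2 hm => ?_⟩
  exact not_dvd_of_prime_gt (p := 2) (by norm_num) (by omega) hm (by omega)

/-- **Sextuplet progressions**: if `n, n+6, n+12, n+16, n+18, n+22` are prime and `n ≥ 11` then
`n ≡ 1 (mod 3)`, `n ≡ 1 (mod 5)`, `n ≡ 4 (mod 7)`, so `3 ∣ n+2, n+8`, `5 ∣ n+4`, `7 ∣ n+10` and the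
odd offsets are even: the only prime strictly between `n` and `n + 12` is `n + 6`. -/
theorem cpap3_of_sextuplet {n : ℕ} (hn : 11 ≤ n) (h0 : n.Prime) (h6 : (n + 6).Prime)
    (h12 : (n + 12).Prime) (h16 : (n + 16).Prime) (h18 : (n + 18).Prime) (h22 : (n + 22).Prime) :
    ∀ m : ℕ, n < m → m < n + 12 → m.Prime → m = n + 6 := by
  have a2 := not_dvd_of_prime_gt (p := 2) (by norm_num) (by omega) h0
  have a3 := not_dvd_of_prime_gt (p := 3) (by norm_num) (by omega) h0
  have b3 := not_dvd_of_prime_gt (p := 3) (by norm_num) (by omega) h16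
  have a5 := not_dvd_of_prime_gt (p := 5) (by norm_num) (by omega) h0
  have b5 := not_dvd_of_prime_gt (p := 5) (by norm_num) (by omega) h6
  have c5 := not_dvd_of_prime_gt (p := 5) (by norm_num) (by omega) h12
  have d5 := not_dvd_of_prime_gt (p := 5) (by norm_num) (by omega) h18
  have a7 := not_dvd_of_prime_gt (p := 7) (by norm_num) (by omega) h0
  have b7 := not_dvd_of_prime_gt (p := 7) (by norm_num) (by omega) h6
  have c7 := not_dvd_of_prime_gt (p := 7) (by norm_num) (by omega) h12
  have d7 := not_dvd_of_prime_gt (p := 7) (by norm_num) (by omega) h16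
  have e7 := not_dvd_of_prime_gt (p := 7) (by norm_num) (by omega) h18
  have f7 := not_dvd_of_prime_gt (p := 7) (by norm_num) (by omega) h22
  have r2 : n % 2 = 1 := by omega
  have r3 : n % 3 = 1 := by
    have := Nat.mod_lt n (show 0 < 3 by norm_num)
    interval_cases h : n % 3 <;> omega
  have r5 : n % 5 = 1 := by
    have := Nat.mod_lt n (show 0 < 5 by norm_num)
    interval_cases h : n % 5 <;> omega
  have r7 : n % 7 = 4 := by
    have := Nat.mod_lt n (show 0 < 7 by norm_num)
    interval_cases h : n % 7 <;> omega
  clear a2 a3 b3 a5 b5 c5 d5 a7 b7 c7 d7 e7 f7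
  intro m hm1 hm2 hm
  obtain ⟨k, rfl⟩ := Nat.exists_eq_add_of_lt hm1
  have hk : k < 11 := by omega
  interval_cases k <;> first
    | omega
    | exact (not_dvd_of_prime_gt (p := 2) (by norm_num) (by omega) hm (by omega)).elim
    | exact (not_dvd_of_prime_gt (p := 3) (by norm_num) (by omega) hm (by omega)).elim
    | exact (not_dvd_of_prime_gt (p := 5) (by norm_num) (by omega) hm (by omega)).elim
    | exact (not_dvd_of_prime_gt (p := 7) (by norm_num) (by omega) hm (by omega)).elim

/-! ## §3 Necessity (every word is a consequence of the leaf / the conjunct / the root) and exactness -/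

/-- **Necessity edge `FixedLower (26863) ⟹ DecadeStep (32327)`** (FL alone: no Siegel input, no upper bound). -/
theorem decadeStep_of_fixedLower (hFL : FixedLower) : DecadeStep := by
  intro N
  obtain ⟨n, hn, h0, h2, h6, h8⟩ :=
    Filter.frequently_atTop.mp (frequently_quadruplet_of_fixedLower hFL) (max N 7)
  obtain ⟨hd1, hd3, hgap⟩ := decade_of_quadruplet (le_of_max_le_right hn) h0 h2 h6 h8
  exact ⟨n, n + 2, le_of_max_le_left hn, by omega, h0, h2, hgap, hd1, hd3⟩

/-- **Necessity edge `FixedLower (26863) ⟹ EqualGapTriple (32337)`** (FL alone). -/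
theorem equalGapTriple_of_fixedLower (hFL : FixedLower) : EqualGapTriple := by
  intro N
  obtain ⟨n, hn, h0, h6, h12, h16, h18, h22⟩ :=
    Filter.frequently_atTop.mp (frequently_sextuplet_of_fixedLower hFL) (max N 11)
  have hcons := cpap3_of_sextuplet (le_of_max_le_right hn) h0 h6 h12 h16 h18 h22
  exact ⟨n, n + 6, n + 12, le_of_max_le_left hn, by omega, by omega, h0, h6, h12, hcons, by omega⟩

/-- `FixedLower →` the (uncatalogued) residual «WordLift» `DecadeStep → EqualGapTriple → FixedLower`
(trivial: the lift's consequent). -/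
theorem wordLift_of_fixedLower (h : FixedLower) : DecadeStep → EqualGapTriple → FixedLower := fun _ _ => h

/-- The two words and the lift give the leaf back (modus ponens). -/
theorem fixedLower_of_pieces (hD : DecadeStep) (hE : EqualGapTriple)
    (hW : DecadeStep → EqualGapTriple → FixedLower) : FixedLower :=
  hW hD hE

/-- **The node's ONE EQUIV** (lens-3 certified translation + split beneath):
`FixedLower ⟺ DecadeStep ∧ EqualGapTriple ∧ WordLift`, the residual spelled inline. -/
theorem fixedLower_iff :
    FixedLower ↔ DecadeStep ∧ EqualGapTriple ∧ (DecadeStep → EqualGapTriple → FixedLower) :=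
  ⟨fun h => ⟨decadeStep_of_fixedLower h, equalGapTriple_of_fixedLower h, wordLift_of_fixedLower h⟩,
    fun h => fixedLower_of_pieces h.1 h.2.1 h.2.2⟩

/-- **T21 normal form**: given the two words, the residual IS the leaf — which is why «WordLift» is not
catalogued as an item. -/
theorem wordLift_iff_fixedLower (hD : DecadeStep) (hE : EqualGapTriple) :
    (DecadeStep → EqualGapTriple → FixedLower) ↔ FixedLower :=
  ⟨fun hW => hW hD hE, wordLift_of_fixedLower⟩

/-- Necessity from the conjunct: `GHL ⟹ DecadeStep` (tree: `ShiftedPrimeFactor.fixedLower_of_ghl`). -/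
theorem decadeStep_of_ghl (h : _root_.GeneralizedHardyLittlewood) : DecadeStep :=
  decadeStep_of_fixedLower
    (Summit.Parity.GeneralizedHardyLittlewood.Theses.ShiftedPrimeFactor.fixedLower_of_ghl h)

/-- Necessity from the conjunct: `GHL ⟹ EqualGapTriple`. -/
theorem equalGapTriple_of_ghl (h : _root_.GeneralizedHardyLittlewood) : EqualGapTriple :=
  equalGapTriple_of_fixedLower
    (Summit.Parity.GeneralizedHardyLittlewood.Theses.ShiftedPrimeFactor.fixedLower_of_ghl h)

/-- Necessity from the conjunct: both words and the lift. -/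
theorem pieces_of_ghl (h : _root_.GeneralizedHardyLittlewood) :
    DecadeStep ∧ EqualGapTriple ∧ (DecadeStep → EqualGapTriple → FixedLower) :=
  fixedLower_iff.mp
    (Summit.Parity.GeneralizedHardyLittlewood.Theses.ShiftedPrimeFactor.fixedLower_of_ghl h)

/-- Necessity from the root `Parity = BatemanHorn ∧ GeneralizedHardyLittlewood`. -/
theorem pieces_of_parity (h : Parity) :
    DecadeStep ∧ EqualGapTriple ∧ (DecadeStep → EqualGapTriple → FixedLower) :=
  pieces_of_ghl h.2

/-- `Parity ⟹ DecadeStep`. -/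
theorem decadeStep_of_parity (h : Parity) : DecadeStep := (pieces_of_parity h).1

/-- `Parity ⟹ EqualGapTriple`. -/
theorem equalGapTriple_of_parity (h : Parity) : EqualGapTriple := (pieces_of_parity h).2.1

/-! ## §4 The cone to the conjunct through the record route -/

/-- **`closes_via_record`**: `Q → FixedUpper → UniformUpperGivenFixed → DecadeStep → EqualGapTriple → WordLift →
UniformLowerGivenFixed → GeneralizedHardyLittlewood`, through `SiegelSpectrumSplit.closes` and the two
landed glue theorems of the record route. -/
theorem closes_via_record (hQ : BoundedSiegelZeroQuality) (hFU : FixedUpper) (hUU : UniformUpperGivenFixed)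
    (hD : DecadeStep) (hE : EqualGapTriple) (hW : DecadeStep → EqualGapTriple → FixedLower)
    (hUL : UniformLowerGivenFixed) : _root_.GeneralizedHardyLittlewood :=
  Summit.Parity.GeneralizedHardyLittlewood.Theses.SiegelSpectrumSplit.closes hQ
    (upperGivenBoundedSiegelGlue_holds hFU hUU)
    (lowerGivenBoundedSiegelGlue_holds (fixedLower_of_pieces hD hE hW) hUL)

/-- The same reaches the root given the other conjunct. -/
theorem closes_root (hBH : BatemanHorn) (hQ : BoundedSiegelZeroQuality) (hFU : FixedUpper)
    (hUU : UniformUpperGivenFixed) (hD : DecadeStep) (hE : EqualGapTriple)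
    (hW : DecadeStep → EqualGapTriple → FixedLower) (hUL : UniformLowerGivenFixed) : Parity :=
  ⟨hBH, closes_via_record hQ hFU hUU hD hE hW hUL⟩

/-- **`node_iff`**: modulo the record's own necessity `GHL → Q` (SiegelSpectrumSplit files `Q` as a
crux of GHL), the conjunct is EQUIVALENT to the seven binders of `closes_via_record`. -/
theorem node_iff (hQ_of_ghl : _root_.GeneralizedHardyLittlewood → BoundedSiegelZeroQuality) :
    _root_.GeneralizedHardyLittlewood ↔
      (BoundedSiegelZeroQuality ∧ FixedUpper ∧ UniformUpperGivenFixed ∧ DecadeStep ∧ EqualGapTriple ∧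
        (DecadeStep → EqualGapTriple → FixedLower) ∧ UniformLowerGivenFixed) :=
  ⟨fun h => ⟨hQ_of_ghl h,
      Summit.Parity.GeneralizedHardyLittlewood.Theses.ShiftedPrimeFactor.fixedUpper_of_ghl h,
      Summit.Parity.GeneralizedHardyLittlewood.Theses.ShiftedPrimeFactor.uniformUpperGivenFixed_of_ghl h,
      decadeStep_of_ghl h, equalGapTriple_of_ghl h,
      wordLift_of_fixedLower
        (Summit.Parity.GeneralizedHardyLittlewood.Theses.ShiftedPrimeFactor.fixedLower_of_ghl h),
      Summit.Parity.GeneralizedHardyLittlewood.Theses.ShiftedPrimeFactor.uniformLowerGivenFixed_of_ghl h⟩,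
    fun h => closes_via_record h.1 h.2.1 h.2.2.1 h.2.2.2.1 h.2.2.2.2.1 h.2.2.2.2.2.1 h.2.2.2.2.2.2⟩

end Summit.Parity.GeneralizedHardyLittlewood.ConsecutivePrimeWords
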